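import Literature.NumberTheory.Automorphic.BCDTTheoremBWildAtThreeTwist
import Literature.NumberTheory.GaloisRepresentations.FramedRepTwist
import HarnessLib

/-!
# BCDT Theorem 2.2.1, cases 2–6: the normalisations "`-1 ↦ 1`" and "`3 ↦ τⁱ(τ - τ⁻¹)`" by the quadratic twists `ε₋₃`, `ε₋₁`

Topic `NumberTheory/Automorphic`; a companion of `…BCDTTheoremBWildAtThree{,Det,Cases,Twist}`,
landed by the tenured seat of the named fact `Literature.NumberTheory.Automorphic.BCDT.theoremB`
(Breuil–Conrad–Diamond–Taylor 2001, Thm. B = Thm. 2.2.1) as a further bottom-up step INSIDE the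
wild case of its printed proof (BCDT §2.2, cases 2–6).

C. Breuil, B. Conrad, F. Diamond, R. Taylor, J. Amer. Math. Soc. 14 (2001) [BCDTJAMS2001], proof of
Theorem 2.2.1 (p. 860): *"Then up to equivalence and twisting by a quadratic character, one of the
following possibilities can be attained. 1. `ρ̄` is tamely ramified at `3`. 2. `ρ̄|_{G₃}` is given
by the character … `3 ↦ τⁱ(τ - τ⁻¹)`, `-1 ↦ 1`, `4 ↦ τ`. 3. … 4.–6. … `√±3 ↦ τ - τ⁻¹`,
`-1 ↦ -1` …"*.
`…WildAtThreeCases` determined the images (inertia `⟨τ⟩`, `⟨τ, -1⟩` or `⟨τ, σ⟩`; Frobenius `±τⁱν`,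
`ν = τ - τ⁻¹`) and `…WildAtThreeTwist` identified the sign on inertia as `χ̄₃`.  With the twist of
framed representations (`FramedRep.twist`, `GaloisRepresentations/FramedRepTwist`) this file carries
out the two normalisations "up to twisting by a quadratic character":

* `BCDT.epsNegThree` — the quadratic character **`ε₋₃ : Γ_ℚ → {±1} ⊂ 𝔽₅^×`** of `ℚ(√-3) = ℚ(ζ₃)`
  (`χ̄₃` followed by `(ℤ/3)^× = {±1} ↪ 𝔽₅^×`); `BCDT.epsNegOne` — the quadratic character
  **`ε₋₁`** of `ℚ(√-1) = ℚ(ζ₄)` (`χ̄₄` followed by `(ℤ/4)^× = {±1} ↪ 𝔽₅^×`;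
  `continuous_modNCyclotomicCharacter`), **unramified at `3` with `ε₋₁(Frob₃) = -1`**
  (`epsNegOne_eq_one_of_mem_inertia`, `epsNegOne_of_isArithFrobAt`);
* `det_twist_epsNegThree`, `det_twist_epsNegOne` — both twists preserve the determinant (rank `2`,
  `ε² = 1`), and `isTamelyRamifiedAbove_three_twist_eps{NegThree,NegOne}_iff` — both are tame at `3`;
* **`BCDT.map_inertia_conj_twist_epsNegThree_eq_zpowers_tau`** — if `ρ̄ˣ` maps the wild groups at
  `𝔓 ∣ 3` into `⟨τ⟩` and `ρ̄ˣ(I_𝔓) = ⟨τ, -1⟩` ("`-1 ↦ -1`" in cases 2–3), then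
  **`(ρ̄ ⊗ ε₋₃)ˣ(I_𝔓) = ⟨τ⟩`** ("`-1 ↦ 1`");
* **`BCDT.exists_twist_epsNegOne_isArithFrobAt_apply_eq_nu`** — if some Frobenius has
  `ρ̄ˣ(φ) ∈ 𝔽₅(τ)^×` of norm `3` (so `= ±τⁱν`), then for `ρ̄' ∈ {ρ̄, ρ̄ ⊗ ε₋₁}` some Frobenius has
  **`ρ̄'ˣ(φ') = ν`** — the inertia image being untouched (`map_inertia_conj_twist_epsNegOne`);
* **`BCDT.exists_twist_conj_of_not_isTamelyRamifiedAbove_three_of_det`** — for `ρ̄ : Γ_ℚ → GL₂(𝔽₅)`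
  continuous with `det ρ̄ = χ̄₅`, not tamely ramified above `3`: **up to replacing `ρ̄` by its twist
  by one of `1, ε₋₃, ε₋₁, ε₋₃ε₋₁`** (keeping `det = χ̄₅` and the wildness at `3`), at some `𝔓 ∣ 3` and
  after a conjugation: `f(D_𝔓) ≤ N(𝔽₅(τ)^×)`, wild groups into/onto `⟨τ⟩`, and either
  `f(I_𝔓) = ⟨τ⟩` with — in case 2, `D_𝔓 ≤ H` — a Frobenius of value exactly `ν = τ - τ⁻¹`
  (BCDT's case 2 normal form "`3 ↦ τⁱ(τ - τ⁻¹)`, `-1 ↦ 1`, `4 ↦ τ`", the `τⁱ` absorbed into the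
  Frobenius; case 3 when `D_𝔓 ≰ H`), or `f(I_𝔓) = ⟨τ, σ⟩` with a Frobenius `φ ∈ H` of value `ν`
  (cases 4–6, "`√±3 ↦ τ - τ⁻¹`").

What is NOT done here (unchanged): the identification of `D_𝔓` with `G₃ = Gal(ℚ̄₃/ℚ₃)` and local
class field theory (the printed characters of `ℚ₃^×`, `ℚ₃(√-1)^×`, `ℚ₃(√±3)^×`), and the
twist-invariance of the modularity of `ρ̄`.

## References

* [BCDTJAMS2001] C. Breuil, B. Conrad, F. Diamond, R. Taylor, J. Amer. Math. Soc. 14 (2001),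
  §2.2, proof of Thm. 2.2.1, p. 860 (cases 2–6: "up to … twisting by a quadratic character").
* [Serre1987] J.-P. Serre, Duke Math. J. 54 (1987), §2.2 (twists `ρ ⊗ χ^m`).
-/

noncomputable section

open scoped NumberField Pointwise
open IsDedekindDomain Field

namespace Literature.NumberTheory.Automorphic.BCDT

open GaloisRepresentations GaloisRepresentations.GL2F5OrderThree

/-! ## The quadratic character `ε₋₃ : Γ_ℚ → {±1} ⊂ 𝔽₅^×` -/

/-- The injective homomorphism `(ℤ/3)^× = {±1} → 𝔽₅^×`, `±1 ↦ ±1`. [folklore] -/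
def unitsZModThreeHom : (ZMod 3)ˣ →* (ZMod 5)ˣ :=
  MonoidHom.mk' (fun u ↦ if u = 1 then 1 else -1) (by decide)

/-- `1 ↦ 1`. [folklore] -/
@[simp] theorem unitsZModThreeHom_one : unitsZModThreeHom 1 = 1 := by decide

/-- `-1 ↦ -1`. [folklore] -/
@[simp] theorem unitsZModThreeHom_neg_one : unitsZModThreeHom (-1) = -1 := by decide

/-- `unitsZModThreeHom u = 1 ⇔ u = 1`. [folklore] -/
theorem unitsZModThreeHom_eq_one_iff (u : (ZMod 3)ˣ) : unitsZModThreeHom u = 1 ↔ u = 1 := by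
  revert u; decide

/-- **The quadratic character `ε₋₃` of `ℚ(√-3) = ℚ(ζ₃)` with values in `𝔽₅^×`**: the mod-`3`
cyclotomic character `χ̄₃ : Γ_ℚ → (ℤ/3)^× = {±1}` followed by `{±1} ⊂ 𝔽₅^×` (continuous: `χ̄₃` is).
This is the quadratic character by which BCDT twist in the proof of Thm. 2.2.1 to attain
"`-1 ↦ 1`" on inertia at `3` (`…WildAtThreeTwist`: the sign on `I_𝔓` is `χ̄₃`).
[cite: BCDTJAMS2001, §2.2 (proof of Thm. 2.2.1, p. 860: "twisting by a quadratic character")] -/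
def epsNegThree : absoluteGaloisGroup ℚ →ₜ* (ZMod 5)ˣ :=
  ContinuousMonoidHom.comp ⟨unitsZModThreeHom, continuous_of_discreteTopology⟩
    (modPCyclotomicCharacter ℚ (ZMod 3) 3 (RingHom.id _))

/-- Unfolding: `ε₋₃(g)` is the image of `χ̄₃(g) ∈ (ℤ/3)^×`. [folklore] -/
theorem epsNegThree_apply (g : absoluteGaloisGroup ℚ) :
    epsNegThree g = unitsZModThreeHom (modPCyclotomicCharacterZMod ℚ 3 g) := by
  change unitsZModThreeHom (modPCyclotomicCharacter ℚ (ZMod 3) 3 (RingHom.id _) g) = _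
  congr 1

/-- `ε₋₃(g) = 1 ⇔ χ̄₃(g) = 1`. [folklore] -/
theorem epsNegThree_eq_one_iff (g : absoluteGaloisGroup ℚ) :
    epsNegThree g = 1 ↔ modPCyclotomicCharacterZMod ℚ 3 g = 1 := by
  rw [epsNegThree_apply, unitsZModThreeHom_eq_one_iff]

/-- `ε₋₃(g) = -1 ⇔ χ̄₃(g) = -1`, and `ε₋₃` takes only the values `±1`. [folklore] -/
theorem epsNegThree_eq_one_or (g : absoluteGaloisGroup ℚ) : epsNegThree g = 1 ∨ epsNegThree g = -1 := by
  rw [epsNegThree_apply]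
  rcases ZMod.units_three_eq_one_or (modPCyclotomicCharacterZMod ℚ 3 g) with h | h
  · left; rw [h, unitsZModThreeHom_one]
  · right; rw [h, unitsZModThreeHom_neg_one]

/-- `ε₋₃(g) = -1` when `χ̄₃(g) = -1`. [folklore] -/
theorem epsNegThree_eq_neg_one_of (g : absoluteGaloisGroup ℚ) (h : modPCyclotomicCharacterZMod ℚ 3 g = -1) :
    epsNegThree g = -1 := by
  rw [epsNegThree_apply, h, unitsZModThreeHom_neg_one]

/-- `ε₋₃` is quadratic: `ε₋₃(g)² = 1`. [folklore] -/
theorem epsNegThree_sq (g : absoluteGaloisGroup ℚ) : epsNegThree g ^ 2 = 1 := by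
  rcases epsNegThree_eq_one_or g with h | h
  · rw [h, one_pow]
  · rw [h, neg_one_sq]

/-- `ε₋₃` is trivial on the wild ramification groups at `3` (`χ̄₃` is). [folklore] -/
theorem epsNegThree_eq_one_of_mem_absUpperRamificationSubgroup {v : HeightOneSpectrum (𝓞 ℚ)}
    (hv : ((3 : ℕ) : 𝓞 ℚ) ∈ v.asIdeal) {𝔓 : Ideal (absIntegers (𝓞 ℚ) ℚ)} (h𝔓 : 𝔓 ∈ v.primesAbove)
    {u : ℝ} (hu : 0 < u) {w : absoluteGaloisGroup ℚ}
    (hw : w ∈ absUpperRamificationSubgroup (𝓞 ℚ) 𝔓 u) : epsNegThree w = 1 :=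
  (epsNegThree_eq_one_iff w).mpr
    (modPCyclotomicCharacterZMod_three_eq_one_of_mem_absUpperRamificationSubgroup hv h𝔓 hu hw)

/-! ## Twisting `ρ̄ : Γ_ℚ → GL₂(𝔽₅)` by `ε₋₃` -/

/-- **The twist by `ε₋₃` preserves the determinant** (rank `2`, `ε₋₃² = 1`): in particular a
cyclotomic determinant stays cyclotomic. [folklore] -/
theorem det_twist_epsNegThree (ρ : ModPGaloisRep ℚ (ZMod 5) 2) (g : absoluteGaloisGroup ℚ) :
    Matrix.GeneralLinearGroup.det (ρ.twist epsNegThree g) = Matrix.GeneralLinearGroup.det (ρ g) := by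
  rw [FramedRep.det_twist_apply, epsNegThree_sq, one_mul]

/-- `ρ̄ ⊗ ε₋₃` agrees with `ρ̄` on the wild ramification groups at `3`. [folklore] -/
theorem twist_epsNegThree_apply_of_mem_absUpperRamificationSubgroup (ρ : ModPGaloisRep ℚ (ZMod 5) 2)
    {v : HeightOneSpectrum (𝓞 ℚ)} (hv : ((3 : ℕ) : 𝓞 ℚ) ∈ v.asIdeal)
    {𝔓 : Ideal (absIntegers (𝓞 ℚ) ℚ)} (h𝔓 : 𝔓 ∈ v.primesAbove) {u : ℝ} (hu : 0 < u)
    {w : absoluteGaloisGroup ℚ} (hw : w ∈ absUpperRamificationSubgroup (𝓞 ℚ) 𝔓 u) :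
    ρ.twist epsNegThree w = ρ w :=
  FramedRep.twist_apply_of_eq_one ρ epsNegThree
    (epsNegThree_eq_one_of_mem_absUpperRamificationSubgroup hv h𝔓 hu hw)

/-- **`ρ̄ ⊗ ε₋₃` is tamely ramified above `3` iff `ρ̄` is** (`ε₋₃` is tame at `3`). [folklore] -/
theorem isTamelyRamifiedAbove_three_twist_epsNegThree_iff (ρ : ModPGaloisRep ℚ (ZMod 5) 2) :
    FramedGaloisRep.IsTamelyRamifiedAbove 3 (ρ.twist epsNegThree) ↔ ρ.IsTamelyRamifiedAbove 3 := by
  constructor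
  · intro h v hv 𝔓 h𝔓 u hu σ hσ
    rw [← twist_epsNegThree_apply_of_mem_absUpperRamificationSubgroup ρ hv h𝔓 hu hσ]
    exact h v hv 𝔓 h𝔓 u hu σ hσ
  · intro h v hv 𝔓 h𝔓 u hu σ hσ
    rw [twist_epsNegThree_apply_of_mem_absUpperRamificationSubgroup ρ hv h𝔓 hu hσ]
    exact h v hv 𝔓 h𝔓 u hu σ hσ

/-- The conjugated twist differs from the conjugate by the central sign `ε₋₃(g) = ±1`:
`x (ρ̄ ⊗ ε₋₃)(g) x⁻¹ = x ρ̄(g) x⁻¹` if `ε₋₃(g) = 1` and `= -x ρ̄(g) x⁻¹` if `ε₋₃(g) = -1`. [folklore] -/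
theorem conj_twist_epsNegThree_apply (ρ : ModPGaloisRep ℚ (ZMod 5) 2) (x : GL (Fin 2) (ZMod 5))
    (g : absoluteGaloisGroup ℚ) :
    (epsNegThree g = 1 ∧ x * ρ.twist epsNegThree g * x⁻¹ = x * ρ g * x⁻¹) ∨
      (epsNegThree g = -1 ∧ x * ρ.twist epsNegThree g * x⁻¹ = -(x * ρ g * x⁻¹)) := by
  rcases epsNegThree_eq_one_or g with h | h
  · left
    exact ⟨h, by rw [FramedRep.twist_apply_of_eq_one ρ epsNegThree h]⟩
  · right
    refine ⟨h, ?_⟩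
    rw [FramedRep.twist_apply_of_eq_neg_one ρ epsNegThree h, mul_neg, neg_mul]

/-! ## The normalisation "`-1 ↦ 1`" -/

section Normalise

variable (ρ : ModPGaloisRep ℚ (ZMod 5) 2) (x : GL (Fin 2) (ZMod 5))
  {v : HeightOneSpectrum (𝓞 ℚ)} {𝔓 : Ideal (absIntegers (𝓞 ℚ) ℚ)}

/-- The wild groups keep their image `⊆ ⟨τ⟩` under the twisted conjugate. [folklore] -/
theorem conj_twist_epsNegThree_apply_mem_zpowers_tau (hv : ((3 : ℕ) : 𝓞 ℚ) ∈ v.asIdeal)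
    (h𝔓 : 𝔓 ∈ v.primesAbove)
    (hwle : ∀ u : ℝ, 0 < u → ∀ σ ∈ absUpperRamificationSubgroup (𝓞 ℚ) 𝔓 u,
      x * ρ σ * x⁻¹ ∈ Subgroup.zpowers tau)
    {u : ℝ} (hu : 0 < u) {σ : absoluteGaloisGroup ℚ} (hσ : σ ∈ absUpperRamificationSubgroup (𝓞 ℚ) 𝔓 u) :
    x * ρ.twist epsNegThree σ * x⁻¹ ∈ Subgroup.zpowers tau := by
  rw [twist_epsNegThree_apply_of_mem_absUpperRamificationSubgroup ρ hv h𝔓 hu hσ]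
  exact hwle u hu σ hσ

/-- The image of a wild group under the twisted conjugate equals its image under the conjugate.
[folklore] -/
theorem map_absUpperRamificationSubgroup_conj_twist_epsNegThree (hv : ((3 : ℕ) : 𝓞 ℚ) ∈ v.asIdeal)
    (h𝔓 : 𝔓 ∈ v.primesAbove) {u : ℝ} (hu : 0 < u) :
    (absUpperRamificationSubgroup (𝓞 ℚ) 𝔓 u).map
        ((MulAut.conj x).toMonoidHom.comp (ρ.twist epsNegThree).toMonoidHom) =
      (absUpperRamificationSubgroup (𝓞 ℚ) 𝔓 u).map ((MulAut.conj x).toMonoidHom.comp ρ.toMonoidHom) := by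
  apply le_antisymm
  · rintro _ ⟨σ, hσ, rfl⟩
    refine ⟨σ, hσ, ?_⟩
    change x * ρ σ * x⁻¹ = x * ρ.twist epsNegThree σ * x⁻¹
    rw [twist_epsNegThree_apply_of_mem_absUpperRamificationSubgroup ρ hv h𝔓 hu hσ]
  · rintro _ ⟨σ, hσ, rfl⟩
    refine ⟨σ, hσ, ?_⟩
    change x * ρ.twist epsNegThree σ * x⁻¹ = x * ρ σ * x⁻¹
    rw [twist_epsNegThree_apply_of_mem_absUpperRamificationSubgroup ρ hv h𝔓 hu hσ]

/-- The decomposition group keeps mapping into `N(𝔽₅(τ)^×)` under the twisted conjugate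
(`-1` is central). [folklore] -/
theorem conj_twist_epsNegThree_apply_mem_normalizer
    (hN : ∀ σ ∈ 𝔓.decompositionSubgroup (absoluteGaloisGroup ℚ),
      x * ρ σ * x⁻¹ ∈ Subgroup.normalizer (unitsF5Tau : Set (GL (Fin 2) (ZMod 5))))
    {σ : absoluteGaloisGroup ℚ} (hσ : σ ∈ 𝔓.decompositionSubgroup (absoluteGaloisGroup ℚ)) :
    x * ρ.twist epsNegThree σ * x⁻¹ ∈ Subgroup.normalizer (unitsF5Tau : Set (GL (Fin 2) (ZMod 5))) := by
  rcases conj_twist_epsNegThree_apply ρ x σ with ⟨-, h⟩ | ⟨-, h⟩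
  · rw [h]; exact hN σ hσ
  · rw [h, ← neg_one_mul]
    exact mul_mem (unitsF5Tau_le_normalizer neg_one_mem_unitsF5Tau) (hN σ hσ)

/-- **Cases 2–3, normalised: `(ρ̄ ⊗ ε₋₃)ˣ(I_𝔓) = ⟨τ⟩`.**  If `ρ̄ˣ = xρ̄x⁻¹` maps the wild groups at
`𝔓 ∣ 3` into `⟨τ⟩` and `ρ̄ˣ(I_𝔓) = ⟨τ, -1⟩` ("`-1 ↦ -1`"), then the twist by the quadratic character
`ε₋₃` has `(ρ̄ ⊗ ε₋₃)ˣ(I_𝔓) = ⟨τ⟩` ("`-1 ↦ 1`"): on `I_𝔓` the sign of `ρ̄ˣ` is `χ̄₃`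
(`apply_mem_zpowers_tau_iff_of_map_inertia_eq_closure_tau_neg_one`), which `ε₋₃` cancels.
[cite: BCDTJAMS2001, §2.2 (proof of Thm. 2.2.1, p. 860: "up to … twisting by a quadratic character", case 2 "-1 ↦ 1")] -/
theorem map_inertia_conj_twist_epsNegThree_eq_zpowers_tau (hv : ((3 : ℕ) : 𝓞 ℚ) ∈ v.asIdeal)
    (h𝔓 : 𝔓 ∈ v.primesAbove)
    (hwle : ∀ u : ℝ, 0 < u → ∀ σ ∈ absUpperRamificationSubgroup (𝓞 ℚ) 𝔓 u,
      x * ρ σ * x⁻¹ ∈ Subgroup.zpowers tau)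
    (hI : (𝔓.inertia (absoluteGaloisGroup ℚ)).map ((MulAut.conj x).toMonoidHom.comp ρ.toMonoidHom) =
      Subgroup.closure {tau, -1}) :
    (𝔓.inertia (absoluteGaloisGroup ℚ)).map
        ((MulAut.conj x).toMonoidHom.comp (ρ.twist epsNegThree).toMonoidHom) =
      Subgroup.zpowers tau := by
  have hsign := fun g (hg : g ∈ 𝔓.inertia (absoluteGaloisGroup ℚ)) ↦
    apply_mem_zpowers_tau_iff_of_map_inertia_eq_closure_tau_neg_one ρ x hv h𝔓 hwle hI hg
  apply le_antisymm
  · rintro _ ⟨g, hg, rfl⟩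
    change x * ρ.twist epsNegThree g * x⁻¹ ∈ Subgroup.zpowers tau
    have hgI : x * ρ g * x⁻¹ ∈ Subgroup.closure ({tau, -1} : Set (GL (Fin 2) (ZMod 5))) := by
      rw [← hI]; exact ⟨g, hg, rfl⟩
    rcases conj_twist_epsNegThree_apply ρ x g with ⟨h1, h⟩ | ⟨h1, h⟩
    · rw [h]
      exact (hsign g hg).mpr ((epsNegThree_eq_one_iff g).mp h1)
    · rw [h]
      -- `ε₋₃(g) = -1`, so `χ̄₃(g) ≠ 1` and `x ρ g x⁻¹ ∈ ⟨τ, -1⟩ ∖ ⟨τ⟩ = -⟨τ⟩`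
      have hχ : modPCyclotomicCharacterZMod ℚ 3 g ≠ 1 := by
        intro h'
        rw [(epsNegThree_eq_one_iff g).mpr h'] at h1
        exact absurd h1 (by decide)
      have hnot : x * ρ g * x⁻¹ ∉ Subgroup.zpowers tau := fun h' ↦ hχ ((hsign g hg).mp h')
      have hg' : x * ρ g * x⁻¹ ∈ Subgroup.closure ({tau, sigma} : Set (GL (Fin 2) (ZMod 5))) := by
        refine (Subgroup.closure_le _).mpr ?_ hgI
        intro w hw
        simp only [Set.mem_insert_iff, Set.mem_singleton_iff] at hw
        rcases hw with rfl | rfl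
        · exact Subgroup.subset_closure (by simp)
        · exact neg_one_mem_closure
      have ht : tau ∈ Subgroup.zpowers tau := Subgroup.mem_zpowers tau
      rcases mem_six_of_mem_closure_of_mem_unitsF5Tau hg' (closure_tau_neg_one_le_unitsF5Tau.1 hgI)
        with h6 | h6 | h6 | h6 | h6 | h6
      · exact absurd (h6 ▸ one_mem _) hnot
      · rw [h6, neg_neg]; exact one_mem _
      · exact absurd (h6 ▸ ht) hnot
      · rw [h6, neg_neg]; exact ht
      · exact absurd (h6 ▸ pow_mem ht 2) hnot
      · rw [h6, neg_neg]; exact pow_mem ht 2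
  · -- `τ = x ρ t x⁻¹` for some `t ∈ I_𝔓`, and then `ε₋₃(t) = 1`
    rw [Subgroup.zpowers_le]
    have hτ : tau ∈ (𝔓.inertia (absoluteGaloisGroup ℚ)).map
        ((MulAut.conj x).toMonoidHom.comp ρ.toMonoidHom) := by
      rw [hI]; exact Subgroup.subset_closure (by simp)
    obtain ⟨t, ht, hft⟩ := hτ
    change x * ρ t * x⁻¹ = tau at hft
    have hεt : epsNegThree t = 1 :=
      (epsNegThree_eq_one_iff t).mpr ((hsign t ht).mp (hft ▸ Subgroup.mem_zpowers tau))
    refine ⟨t, ht, ?_⟩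
    change x * ρ.twist epsNegThree t * x⁻¹ = tau
    rw [FramedRep.twist_apply_of_eq_one ρ epsNegThree hεt, hft]

end Normalise

/-! ## The unramified quadratic character `ε₋₁` and the sign of the Frobenius -/

/-- The mod-`N` cyclotomic character of `Γ_ℚ` is continuous (locally constant:
`modNCyclotomicCharacter_eventually_eq_one`). [folklore] -/
theorem continuous_modNCyclotomicCharacter (N : ℕ) [NeZero N] :
    Continuous (modNCyclotomicCharacter ℚ N) := by
  refine continuous_of_continuousAt_one (modNCyclotomicCharacter ℚ N) ?_
  rw [ContinuousAt, map_one]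
  refine Filter.Tendsto.mono_right ?_ (pure_le_nhds 1)
  rw [Filter.tendsto_pure]
  exact modNCyclotomicCharacter_eventually_eq_one ℚ N

/-- The injective homomorphism `(ℤ/4)^× = {±1} → 𝔽₅^×`, `±1 ↦ ±1`. [folklore] -/
def unitsZModFourHom : (ZMod 4)ˣ →* (ZMod 5)ˣ :=
  MonoidHom.mk' (fun u ↦ if u = 1 then 1 else -1) (by decide)

/-- The units of `ℤ/4` are `±1`. [folklore] -/
theorem ZMod.units_four_eq_one_or (u : (ZMod 4)ˣ) : u = 1 ∨ u = -1 := by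
  revert u; decide

/-- **The quadratic character `ε₋₁` of `ℚ(√-1) = ℚ(ζ₄)` with values in `𝔽₅^×`**: the mod-`4`
cyclotomic character `χ̄₄ : Γ_ℚ → (ℤ/4)^× = {±1}` followed by `{±1} ⊂ 𝔽₅^×`.  It is unramified at `3`
and takes the value `-1` at every Frobenius above `3` (`3 ≡ -1 mod 4`): the quadratic character,
unramified at `3`, by which one twists to change the sign of `ρ̄(Frob₃)` without touching inertia.
[cite: BCDTJAMS2001, §2.2 (proof of Thm. 2.2.1, p. 860: "twisting by a quadratic character")] -/
def epsNegOne : absoluteGaloisGroup ℚ →ₜ* (ZMod 5)ˣ :=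
  ContinuousMonoidHom.comp ⟨unitsZModFourHom, continuous_of_discreteTopology⟩
    ⟨modNCyclotomicCharacter ℚ 4, continuous_modNCyclotomicCharacter 4⟩

/-- Unfolding: `ε₋₁(g)` is the image of `χ̄₄(g) ∈ (ℤ/4)^×`. [folklore] -/
theorem epsNegOne_apply (g : absoluteGaloisGroup ℚ) :
    epsNegOne g = unitsZModFourHom (modNCyclotomicCharacter ℚ 4 g) := rfl

/-- `ε₋₁` takes only the values `±1`. [folklore] -/
theorem epsNegOne_eq_one_or (g : absoluteGaloisGroup ℚ) : epsNegOne g = 1 ∨ epsNegOne g = -1 := by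
  rw [epsNegOne_apply]
  rcases ZMod.units_four_eq_one_or (modNCyclotomicCharacter ℚ 4 g) with h | h
  · left; rw [h]; decide
  · right; rw [h]; decide

/-- `ε₋₁` is quadratic. [folklore] -/
theorem epsNegOne_sq (g : absoluteGaloisGroup ℚ) : epsNegOne g ^ 2 = 1 := by
  rcases epsNegOne_eq_one_or g with h | h
  · rw [h, one_pow]
  · rw [h, neg_one_sq]

/-- **`ε₋₁` is unramified at `3`**: it is trivial on the inertia groups above `3` (`χ̄₄` is, `3 ∤ 4`).
[folklore] -/
theorem epsNegOne_eq_one_of_mem_inertia {v : HeightOneSpectrum (𝓞 ℚ)} (hv : ((3 : ℕ) : 𝓞 ℚ) ∈ v.asIdeal)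
    {𝔓 : Ideal (absIntegers (𝓞 ℚ) ℚ)} (h𝔓 : 𝔓 ∈ v.primesAbove) {σ : absoluteGaloisGroup ℚ}
    (hσ : σ ∈ 𝔓.inertia (absoluteGaloisGroup ℚ)) : epsNegOne σ = 1 := by
  rw [epsNegOne_apply, Rat.modNCyclotomicCharacter_eq_one_of_mem_inertia Nat.prime_three
    (by norm_num) hv h𝔓 hσ]
  decide

/-- **`ε₋₁(Frob₃) = -1`**: at every arithmetic Frobenius above `3`, `χ̄₄ = 3 = -1`. [folklore] -/
theorem epsNegOne_of_isArithFrobAt {v : HeightOneSpectrum (𝓞 ℚ)} (hv : ((3 : ℕ) : 𝓞 ℚ) ∈ v.asIdeal)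
    {𝔓 : Ideal (absIntegers (𝓞 ℚ) ℚ)} (h𝔓 : 𝔓 ∈ v.primesAbove) {φ : absoluteGaloisGroup ℚ}
    (hφ : IsArithFrobAt (𝓞 ℚ) φ 𝔓) : epsNegOne φ = -1 := by
  have h3 : modNCyclotomicCharacter ℚ 4 φ = -1 := by
    ext
    rw [Rat.modNCyclotomicCharacter_of_isArithFrobAt Nat.prime_three (by norm_num) hv h𝔓 hφ]
    decide
  rw [epsNegOne_apply, h3]
  decide

/-- The twist by `ε₋₁` preserves the determinant. [folklore] -/
theorem det_twist_epsNegOne (ρ : ModPGaloisRep ℚ (ZMod 5) 2) (g : absoluteGaloisGroup ℚ) :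
    Matrix.GeneralLinearGroup.det (ρ.twist epsNegOne g) = Matrix.GeneralLinearGroup.det (ρ g) := by
  rw [FramedRep.det_twist_apply, epsNegOne_sq, one_mul]

/-- `ρ̄ ⊗ ε₋₁` agrees with `ρ̄` on the inertia groups above `3`. [folklore] -/
theorem twist_epsNegOne_apply_of_mem_inertia (ρ : ModPGaloisRep ℚ (ZMod 5) 2)
    {v : HeightOneSpectrum (𝓞 ℚ)} (hv : ((3 : ℕ) : 𝓞 ℚ) ∈ v.asIdeal)
    {𝔓 : Ideal (absIntegers (𝓞 ℚ) ℚ)} (h𝔓 : 𝔓 ∈ v.primesAbove) {σ : absoluteGaloisGroup ℚ}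
    (hσ : σ ∈ 𝔓.inertia (absoluteGaloisGroup ℚ)) : ρ.twist epsNegOne σ = ρ σ :=
  FramedRep.twist_apply_of_eq_one ρ epsNegOne (epsNegOne_eq_one_of_mem_inertia hv h𝔓 hσ)

/-- `ρ̄ ⊗ ε₋₁` is tamely ramified above `3` iff `ρ̄` is (`ε₋₁` is unramified at `3`). [folklore] -/
theorem isTamelyRamifiedAbove_three_twist_epsNegOne_iff (ρ : ModPGaloisRep ℚ (ZMod 5) 2) :
    FramedGaloisRep.IsTamelyRamifiedAbove 3 (ρ.twist epsNegOne) ↔ ρ.IsTamelyRamifiedAbove 3 := by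
  have key : ∀ (v : HeightOneSpectrum (𝓞 ℚ)), ((3 : ℕ) : 𝓞 ℚ) ∈ v.asIdeal →
      ∀ 𝔓 ∈ v.primesAbove, ∀ u : ℝ, ∀ σ ∈ absUpperRamificationSubgroup (𝓞 ℚ) 𝔓 u,
        ρ.twist epsNegOne σ = ρ σ := fun v hv 𝔓 h𝔓 u σ hσ ↦
    twist_epsNegOne_apply_of_mem_inertia ρ hv h𝔓
      (absUpperRamificationSubgroup_le_inertia_holds (𝓞 ℚ) 𝔓 u (K := ℚ) hσ)
  constructor
  · intro h v hv 𝔓 h𝔓 u hu σ hσ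
    rw [← key v hv 𝔓 h𝔓 u σ hσ]
    exact h v hv 𝔓 h𝔓 u hu σ hσ
  · intro h v hv 𝔓 h𝔓 u hu σ hσ
    rw [key v hv 𝔓 h𝔓 u σ hσ]
    exact h v hv 𝔓 h𝔓 u hu σ hσ

/-- At an arithmetic Frobenius above `3`, `(ρ̄ ⊗ ε₋₁)(φ) = -ρ̄(φ)`. [folklore] -/
theorem twist_epsNegOne_apply_of_isArithFrobAt (ρ : ModPGaloisRep ℚ (ZMod 5) 2)
    {v : HeightOneSpectrum (𝓞 ℚ)} (hv : ((3 : ℕ) : 𝓞 ℚ) ∈ v.asIdeal)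
    {𝔓 : Ideal (absIntegers (𝓞 ℚ) ℚ)} (h𝔓 : 𝔓 ∈ v.primesAbove) {φ : absoluteGaloisGroup ℚ}
    (hφ : IsArithFrobAt (𝓞 ℚ) φ 𝔓) : ρ.twist epsNegOne φ = -ρ φ :=
  FramedRep.twist_apply_of_eq_neg_one ρ epsNegOne (epsNegOne_of_isArithFrobAt hv h𝔓 hφ)

/-- A twist by a `{±1}`-valued character does not change membership of the conjugated values in a
subgroup containing `-1` (such as `𝔽₅(τ)^×` or its normaliser). [folklore] -/
theorem conj_twist_apply_mem_iff_of_neg_one_mem (ρ : ModPGaloisRep ℚ (ZMod 5) 2) (x : GL (Fin 2) (ZMod 5))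
    (χ : absoluteGaloisGroup ℚ →ₜ* (ZMod 5)ˣ) (hχ : ∀ g, χ g = 1 ∨ χ g = -1)
    {S : Subgroup (GL (Fin 2) (ZMod 5))} (hS : (-1 : GL (Fin 2) (ZMod 5)) ∈ S) (g : absoluteGaloisGroup ℚ) :
    x * ρ.twist χ g * x⁻¹ ∈ S ↔ x * ρ g * x⁻¹ ∈ S := by
  rcases hχ g with h | h
  · rw [FramedRep.twist_apply_of_eq_one ρ χ h]
  · rw [FramedRep.twist_apply_of_eq_neg_one ρ χ h, mul_neg, neg_mul, ← neg_one_mul]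
    constructor
    · intro hm
      have := mul_mem (inv_mem hS) hm
      rwa [← mul_assoc, inv_mul_cancel, one_mul] at this
    · exact fun hm ↦ mul_mem hS hm

section FrobeniusSign

variable (ρ : ModPGaloisRep ℚ (ZMod 5) 2) (x : GL (Fin 2) (ZMod 5))
  {v : HeightOneSpectrum (𝓞 ℚ)} {𝔓 : Ideal (absIntegers (𝓞 ℚ) ℚ)}

/-- The image of inertia is unchanged by the twist by `ε₋₁`. [folklore] -/
theorem map_inertia_conj_twist_epsNegOne (hv : ((3 : ℕ) : 𝓞 ℚ) ∈ v.asIdeal) (h𝔓 : 𝔓 ∈ v.primesAbove) :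
    (𝔓.inertia (absoluteGaloisGroup ℚ)).map ((MulAut.conj x).toMonoidHom.comp (ρ.twist epsNegOne).toMonoidHom) =
      (𝔓.inertia (absoluteGaloisGroup ℚ)).map ((MulAut.conj x).toMonoidHom.comp ρ.toMonoidHom) := by
  apply le_antisymm
  · rintro _ ⟨σ, hσ, rfl⟩
    refine ⟨σ, hσ, ?_⟩
    change x * ρ σ * x⁻¹ = x * ρ.twist epsNegOne σ * x⁻¹
    rw [twist_epsNegOne_apply_of_mem_inertia ρ hv h𝔓 hσ]
  · rintro _ ⟨σ, hσ, rfl⟩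
    refine ⟨σ, hσ, ?_⟩
    change x * ρ.twist epsNegOne σ * x⁻¹ = x * ρ σ * x⁻¹
    rw [twist_epsNegOne_apply_of_mem_inertia ρ hv h𝔓 hσ]

/-- The image of a wild group is unchanged by the twist by `ε₋₁`. [folklore] -/
theorem map_absUpperRamificationSubgroup_conj_twist_epsNegOne (hv : ((3 : ℕ) : 𝓞 ℚ) ∈ v.asIdeal)
    (h𝔓 : 𝔓 ∈ v.primesAbove) (u : ℝ) :
    (absUpperRamificationSubgroup (𝓞 ℚ) 𝔓 u).map
        ((MulAut.conj x).toMonoidHom.comp (ρ.twist epsNegOne).toMonoidHom) =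
      (absUpperRamificationSubgroup (𝓞 ℚ) 𝔓 u).map ((MulAut.conj x).toMonoidHom.comp ρ.toMonoidHom) := by
  have hle := absUpperRamificationSubgroup_le_inertia_holds (𝓞 ℚ) 𝔓 u (K := ℚ)
  apply le_antisymm
  · rintro _ ⟨σ, hσ, rfl⟩
    refine ⟨σ, hσ, ?_⟩
    change x * ρ σ * x⁻¹ = x * ρ.twist epsNegOne σ * x⁻¹
    rw [twist_epsNegOne_apply_of_mem_inertia ρ hv h𝔓 (hle hσ)]
  · rintro _ ⟨σ, hσ, rfl⟩
    refine ⟨σ, hσ, ?_⟩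
    change x * ρ.twist epsNegOne σ * x⁻¹ = x * ρ σ * x⁻¹
    rw [twist_epsNegOne_apply_of_mem_inertia ρ hv h𝔓 (hle hσ)]

/-- **Normalising the sign of the Frobenius by `ε₋₁`** (case 2: "`3 ↦ τⁱ(τ - τ⁻¹)`").  If `t ∈ I_𝔓`
has `ρ̄ˣ(t) = τ` and some arithmetic Frobenius `φ` has `ρ̄ˣ(φ) ∈ 𝔽₅(τ)^×` of determinant `3`
(so `ρ̄ˣ(φ') = ±ν` for a suitable Frobenius `φ'`), then for `ρ̄' = ρ̄` or `ρ̄' = ρ̄ ⊗ ε₋₁` some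
arithmetic Frobenius `φ'` has `ρ̄'ˣ(φ') = ν` exactly (`ε₋₁(Frob₃) = -1` flips the sign).
[cite: BCDTJAMS2001, §2.2 (proof of Thm. 2.2.1, p. 860, case 2)] -/
theorem exists_twist_epsNegOne_isArithFrobAt_apply_eq_nu (hv : ((3 : ℕ) : 𝓞 ℚ) ∈ v.asIdeal)
    (h𝔓 : 𝔓 ∈ v.primesAbove) {t : absoluteGaloisGroup ℚ} (ht : t ∈ 𝔓.inertia (absoluteGaloisGroup ℚ))
    (hft : x * ρ t * x⁻¹ = tau) {φ : absoluteGaloisGroup ℚ} (hφ : IsArithFrobAt (𝓞 ℚ) φ 𝔓)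
    (hφC : x * ρ φ * x⁻¹ ∈ unitsF5Tau)
    (hdet : (Matrix.GeneralLinearGroup.det (x * ρ φ * x⁻¹) : ZMod 5) = 3) :
    ∃ ρ' : ModPGaloisRep ℚ (ZMod 5) 2, (ρ' = ρ ∨ ρ' = ρ.twist epsNegOne) ∧
      ∃ φ' : absoluteGaloisGroup ℚ, IsArithFrobAt (𝓞 ℚ) φ' 𝔓 ∧ x * ρ' φ' * x⁻¹ = nu := by
  haveI : 𝔓.IsPrime := h𝔓.1
  obtain ⟨φ', hφ', h⟩ := exists_isArithFrobAt_apply_eq_nu_or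
    (f := (MulAut.conj x).toMonoidHom.comp ρ.toMonoidHom) ht hft hφ hφC hdet
  rcases h with h | h
  · exact ⟨ρ, Or.inl rfl, φ', hφ', h⟩
  · refine ⟨ρ.twist epsNegOne, Or.inr rfl, φ', hφ', ?_⟩
    rw [twist_epsNegOne_apply_of_isArithFrobAt ρ hv h𝔓 hφ', mul_neg, neg_mul]
    change -(x * ρ φ' * x⁻¹) = nu
    rw [show x * ρ φ' * x⁻¹ = -nu from h, neg_neg]

end FrobeniusSign

/-! ## Assembly: the attainable normal form, up to the quadratic twists `ε₋₃`, `ε₋₁` -/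

/-- **Step "`3 ↦ τⁱ(τ - τ⁻¹)`" for a representation with inertia image `⟨τ⟩`.**  Let `ρ̄₁` have
`det ρ̄₁ = χ̄₅`, `ρ̄₁ˣ(D_𝔓) ≤ N(𝔽₅(τ)^×)`, wild groups into `⟨τ⟩` and `ρ̄₁ˣ(I_𝔓) = ⟨τ⟩` at `𝔓 ∣ 3`.
Then `ρ̄' = ρ̄₁` or `ρ̄' = ρ̄₁ ⊗ ε₋₁` has the same determinant, the same images of `D_𝔓`
(in `N(𝔽₅(τ)^×)`), of the wild groups and of `I_𝔓`, and if `D_𝔓 ≤ H = ρ̄'ˣ⁻¹(𝔽₅(τ)^×)` (case 2)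
some arithmetic Frobenius `φ` has `ρ̄'ˣ(φ) = ν`.
[cite: BCDTJAMS2001, §2.2 (proof of Thm. 2.2.1, p. 860, case 2)] -/
theorem exists_twist_epsNegOne_normalForm (ρ₁ : ModPGaloisRep ℚ (ZMod 5) 2) (x : GL (Fin 2) (ZMod 5))
    {v : HeightOneSpectrum (𝓞 ℚ)} (hv : ((3 : ℕ) : 𝓞 ℚ) ∈ v.asIdeal)
    {𝔓 : Ideal (absIntegers (𝓞 ℚ) ℚ)} (h𝔓 : 𝔓 ∈ v.primesAbove)
    (hdet₁ : ∀ σ : absoluteGaloisGroup ℚ,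
      Matrix.GeneralLinearGroup.det (ρ₁ σ) = modPCyclotomicCharacterZMod ℚ 5 σ)
    (hN₁ : ∀ σ ∈ 𝔓.decompositionSubgroup (absoluteGaloisGroup ℚ),
      x * ρ₁ σ * x⁻¹ ∈ Subgroup.normalizer (unitsF5Tau : Set (GL (Fin 2) (ZMod 5))))
    (hwle₁ : ∀ u : ℝ, 0 < u → ∀ σ ∈ absUpperRamificationSubgroup (𝓞 ℚ) 𝔓 u,
      x * ρ₁ σ * x⁻¹ ∈ Subgroup.zpowers tau)
    (hI₁ : (𝔓.inertia (absoluteGaloisGroup ℚ)).map ((MulAut.conj x).toMonoidHom.comp ρ₁.toMonoidHom) =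
      Subgroup.zpowers tau) :
    ∃ ρ' : ModPGaloisRep ℚ (ZMod 5) 2, (ρ' = ρ₁ ∨ ρ' = ρ₁.twist epsNegOne) ∧
      (∀ σ : absoluteGaloisGroup ℚ,
        Matrix.GeneralLinearGroup.det (ρ' σ) = modPCyclotomicCharacterZMod ℚ 5 σ) ∧
      (∀ σ ∈ 𝔓.decompositionSubgroup (absoluteGaloisGroup ℚ),
        x * ρ' σ * x⁻¹ ∈ Subgroup.normalizer (unitsF5Tau : Set (GL (Fin 2) (ZMod 5)))) ∧
      (∀ u : ℝ, 0 < u → ∀ σ ∈ absUpperRamificationSubgroup (𝓞 ℚ) 𝔓 u,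
        x * ρ' σ * x⁻¹ ∈ Subgroup.zpowers tau) ∧
      (∀ u : ℝ, (absUpperRamificationSubgroup (𝓞 ℚ) 𝔓 u).map
          ((MulAut.conj x).toMonoidHom.comp ρ'.toMonoidHom) =
        (absUpperRamificationSubgroup (𝓞 ℚ) 𝔓 u).map ((MulAut.conj x).toMonoidHom.comp ρ₁.toMonoidHom)) ∧
      (𝔓.inertia (absoluteGaloisGroup ℚ)).map ((MulAut.conj x).toMonoidHom.comp ρ'.toMonoidHom) =
        Subgroup.zpowers tau ∧
      (𝔓.decompositionSubgroup (absoluteGaloisGroup ℚ) ≤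
          unitsF5Tau.comap ((MulAut.conj x).toMonoidHom.comp ρ'.toMonoidHom) →
        ∃ φ : absoluteGaloisGroup ℚ, IsArithFrobAt (𝓞 ℚ) φ 𝔓 ∧ x * ρ' φ * x⁻¹ = nu) := by
  haveI : 𝔓.IsPrime := h𝔓.1
  by_cases hDH : 𝔓.decompositionSubgroup (absoluteGaloisGroup ℚ) ≤
      unitsF5Tau.comap ((MulAut.conj x).toMonoidHom.comp ρ₁.toMonoidHom)
  · -- case 2: normalise the Frobenius
    obtain ⟨φ₀, hφ₀⟩ : ∃ φ : absoluteGaloisGroup ℚ, IsArithFrobAt (𝓞 ℚ) φ 𝔓 :=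
      IsDedekindDomain.HeightOneSpectrum.exists_isArithFrobAt_of_mem_primesAbove_holds h𝔓
    have hφ₀C : x * ρ₁ φ₀ * x⁻¹ ∈ unitsF5Tau := hDH hφ₀.mem_stabilizer
    have hdet3 : (Matrix.GeneralLinearGroup.det (x * ρ₁ φ₀ * x⁻¹) : ZMod 5) = 3 := by
      rw [det_conj_eq, hdet₁]
      exact Rat.modPCyclotomicCharacterZMod_five_of_isArithFrobAt_three hv h𝔓 hφ₀
    obtain ⟨t, ht, hft⟩ : ∃ t ∈ 𝔓.inertia (absoluteGaloisGroup ℚ), x * ρ₁ t * x⁻¹ = tau := by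
      have : tau ∈ (𝔓.inertia (absoluteGaloisGroup ℚ)).map
          ((MulAut.conj x).toMonoidHom.comp ρ₁.toMonoidHom) := by
        rw [hI₁]; exact Subgroup.mem_zpowers tau
      exact this
    obtain ⟨ρ', hρ', φ', hφ', hν⟩ :=
      exists_twist_epsNegOne_isArithFrobAt_apply_eq_nu ρ₁ x hv h𝔓 ht hft hφ₀ hφ₀C hdet3
    refine ⟨ρ', hρ', ?_, ?_, ?_, ?_, ?_, fun _ ↦ ⟨φ', hφ', hν⟩⟩ <;> rcases hρ' with rfl | rfl
    · exact hdet₁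
    · intro σ; rw [det_twist_epsNegOne, hdet₁]
    · exact hN₁
    · intro σ hσ
      exact (conj_twist_apply_mem_iff_of_neg_one_mem ρ₁ x epsNegOne epsNegOne_eq_one_or
        (unitsF5Tau_le_normalizer neg_one_mem_unitsF5Tau) σ).mpr (hN₁ σ hσ)
    · exact hwle₁
    · intro u hu σ hσ
      rw [twist_epsNegOne_apply_of_mem_inertia ρ₁ hv h𝔓
        (absUpperRamificationSubgroup_le_inertia_holds (𝓞 ℚ) 𝔓 u (K := ℚ) hσ)]
      exact hwle₁ u hu σ hσ
    · exact fun u ↦ rfl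
    · exact fun u ↦ map_absUpperRamificationSubgroup_conj_twist_epsNegOne ρ₁ x hv h𝔓 u
    · exact hI₁
    · rw [map_inertia_conj_twist_epsNegOne ρ₁ x hv h𝔓, hI₁]
  · -- case 3: nothing to normalise
    exact ⟨ρ₁, Or.inl rfl, hdet₁, hN₁, hwle₁, fun u ↦ rfl, hI₁, fun h ↦ absurd h hDH⟩

/-- **BCDT, proof of Theorem 2.2.1, cases 2–6: "up to equivalence and twisting by a quadratic
character, one of the following possibilities can be attained" — inertia and Frobenius.**  Let
`ρ̄ : Γ_ℚ → GL₂(𝔽₅)` be continuous with `det ρ̄ = χ̄₅` and NOT tamely ramified above `3`.  Then there is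
a twist `ρ̄'` of `ρ̄` by a quadratic character among `1, ε₋₃, ε₋₁, ε₋₃ε₋₁` — still with `det ρ̄' = χ̄₅`
and not tamely ramified above `3` — a prime `𝔓 ∣ 3` and `x ∈ GL₂(𝔽₅)` such that, with `f = xρ̄'x⁻¹`,
`D = D_𝔓`, `I = I_𝔓`, `H = f⁻¹(𝔽₅(τ)^×)`: `f(D) ≤ N(𝔽₅(τ)^×)`, `f(Γ^u(𝔓)) ≤ ⟨τ⟩` for all `u > 0`
with equality for some `u > 0`, and
* either `f(I) = ⟨τ⟩` ("`-1 ↦ 1`, `4 ↦ τ`": cases 2–3) and, if moreover `D ≤ H` (case 2), some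
  arithmetic Frobenius `φ` has **`f φ = ν = τ - τ⁻¹`** ("`3 ↦ τⁱ(τ - τ⁻¹)`", the `τⁱ` absorbed
  into `φ`);
* or `f(I) = ⟨τ, σ⟩` (cases 4–6) and some arithmetic Frobenius `φ ∈ H` has `f φ = ν`
  ("`√±3 ↦ τ - τ⁻¹`").
[cite: BCDTJAMS2001, §2.2 (proof of Thm. 2.2.1, p. 860, cases 2–6)] -/
theorem exists_twist_conj_of_not_isTamelyRamifiedAbove_three_of_det (ρ : ModPGaloisRep ℚ (ZMod 5) 2)
    (hdet : ∀ σ : absoluteGaloisGroup ℚ,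
      Matrix.GeneralLinearGroup.det (ρ σ) = modPCyclotomicCharacterZMod ℚ 5 σ)
    (hwild : ¬ ρ.IsTamelyRamifiedAbove 3) :
    ∃ ρ' : ModPGaloisRep ℚ (ZMod 5) 2,
      (ρ' = ρ ∨ ρ' = ρ.twist epsNegThree ∨ ρ' = ρ.twist epsNegOne ∨
        ρ' = (ρ.twist epsNegThree).twist epsNegOne) ∧
      (∀ σ : absoluteGaloisGroup ℚ,
        Matrix.GeneralLinearGroup.det (ρ' σ) = modPCyclotomicCharacterZMod ℚ 5 σ) ∧
      ¬ ρ'.IsTamelyRamifiedAbove 3 ∧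
      ∃ v : HeightOneSpectrum (𝓞 ℚ), ((3 : ℕ) : 𝓞 ℚ) ∈ v.asIdeal ∧ ∃ 𝔓 ∈ v.primesAbove,
        ∃ x : GL (Fin 2) (ZMod 5),
          (∀ σ ∈ 𝔓.decompositionSubgroup (absoluteGaloisGroup ℚ),
              x * ρ' σ * x⁻¹ ∈ Subgroup.normalizer (unitsF5Tau : Set (GL (Fin 2) (ZMod 5)))) ∧
          (∀ u : ℝ, 0 < u → ∀ σ ∈ absUpperRamificationSubgroup (𝓞 ℚ) 𝔓 u,
              x * ρ' σ * x⁻¹ ∈ Subgroup.zpowers tau) ∧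
          (∃ u : ℝ, 0 < u ∧
            (absUpperRamificationSubgroup (𝓞 ℚ) 𝔓 u).map
                ((MulAut.conj x).toMonoidHom.comp ρ'.toMonoidHom) = Subgroup.zpowers tau) ∧
          (((𝔓.inertia (absoluteGaloisGroup ℚ)).map ((MulAut.conj x).toMonoidHom.comp ρ'.toMonoidHom) =
                Subgroup.zpowers tau ∧
              (𝔓.decompositionSubgroup (absoluteGaloisGroup ℚ) ≤
                  unitsF5Tau.comap ((MulAut.conj x).toMonoidHom.comp ρ'.toMonoidHom) →
                ∃ φ : absoluteGaloisGroup ℚ, IsArithFrobAt (𝓞 ℚ) φ 𝔓 ∧ x * ρ' φ * x⁻¹ = nu)) ∨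
            ((𝔓.inertia (absoluteGaloisGroup ℚ)).map ((MulAut.conj x).toMonoidHom.comp ρ'.toMonoidHom) =
                Subgroup.closure {tau, sigma} ∧
              ∃ φ : absoluteGaloisGroup ℚ, IsArithFrobAt (𝓞 ℚ) φ 𝔓 ∧
                φ ∈ unitsF5Tau.comap ((MulAut.conj x).toMonoidHom.comp ρ'.toMonoidHom) ∧
                x * ρ' φ * x⁻¹ = nu)) := by
  obtain ⟨v, hv, 𝔓, h𝔓, x, hN, hI, hF, hwle, ⟨u₀, hu₀, hmap⟩, hS₁, -, htri⟩ :=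
    exists_conj_of_not_isTamelyRamifiedAbove_three_of_det ρ hdet hwild
  haveI : 𝔓.IsPrime := h𝔓.1
  rcases htri with hIτ | hIμ | hIS
  · -- `f(I) = ⟨τ⟩`: at most the twist by `ε₋₁`
    obtain ⟨ρ', hρ', hdet', hN', hwle', hmaps, hI', hfrob⟩ :=
      exists_twist_epsNegOne_normalForm ρ x hv h𝔓 hdet hN hwle hIτ
    refine ⟨ρ', ?_, hdet', ?_, v, hv, 𝔓, h𝔓, x, hN', hwle', ⟨u₀, hu₀, by rw [hmaps u₀, hmap]⟩,
      Or.inl ⟨hI', hfrob⟩⟩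
    · rcases hρ' with rfl | rfl
      · exact Or.inl rfl
      · exact Or.inr (Or.inr (Or.inl rfl))
    · rcases hρ' with rfl | rfl
      · exact hwild
      · rwa [isTamelyRamifiedAbove_three_twist_epsNegOne_iff]
  · -- `f(I) = ⟨τ, -1⟩`: twist by `ε₋₃` first, then at most by `ε₋₁`
    set ρ₁ := ρ.twist epsNegThree with hρ₁
    have hdet₁ : ∀ σ : absoluteGaloisGroup ℚ,
        Matrix.GeneralLinearGroup.det (ρ₁ σ) = modPCyclotomicCharacterZMod ℚ 5 σ := fun σ ↦ by
      rw [hρ₁, det_twist_epsNegThree, hdet]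
    have hN₁ : ∀ σ ∈ 𝔓.decompositionSubgroup (absoluteGaloisGroup ℚ),
        x * ρ₁ σ * x⁻¹ ∈ Subgroup.normalizer (unitsF5Tau : Set (GL (Fin 2) (ZMod 5))) :=
      fun σ hσ ↦ conj_twist_epsNegThree_apply_mem_normalizer ρ x hN hσ
    have hwle₁ : ∀ u : ℝ, 0 < u → ∀ σ ∈ absUpperRamificationSubgroup (𝓞 ℚ) 𝔓 u,
        x * ρ₁ σ * x⁻¹ ∈ Subgroup.zpowers tau :=
      fun u hu σ hσ ↦ conj_twist_epsNegThree_apply_mem_zpowers_tau ρ x hv h𝔓 hwle hu hσ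
    have hI₁ := map_inertia_conj_twist_epsNegThree_eq_zpowers_tau ρ x hv h𝔓 hwle hIμ
    obtain ⟨ρ', hρ', hdet', hN', hwle', hmaps, hI', hfrob⟩ :=
      exists_twist_epsNegOne_normalForm ρ₁ x hv h𝔓 hdet₁ hN₁ hwle₁ hI₁
    refine ⟨ρ', ?_, hdet', ?_, v, hv, 𝔓, h𝔓, x, hN', hwle', ⟨u₀, hu₀, ?_⟩, Or.inl ⟨hI', hfrob⟩⟩
    · rcases hρ' with rfl | rfl
      · exact Or.inr (Or.inl rfl)
      · exact Or.inr (Or.inr (Or.inr rfl))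
    · have hwild₁ : ¬ FramedGaloisRep.IsTamelyRamifiedAbove 3 ρ₁ := by
        rwa [hρ₁, isTamelyRamifiedAbove_three_twist_epsNegThree_iff]
      rcases hρ' with rfl | rfl
      · exact hwild₁
      · rwa [isTamelyRamifiedAbove_three_twist_epsNegOne_iff]
    · rw [hmaps u₀, hρ₁, map_absUpperRamificationSubgroup_conj_twist_epsNegThree ρ x hv h𝔓 hu₀, hmap]
  · -- `f(I) = ⟨τ, σ⟩`: no twist; a Frobenius in `H` with value `ν`
    obtain ⟨t, htI, hft⟩ : ∃ t ∈ 𝔓.inertia (absoluteGaloisGroup ℚ), x * ρ t * x⁻¹ = tau :=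
      hS₁ (Subgroup.mem_zpowers tau)
    obtain ⟨s, hsI, hfs⟩ : ∃ s ∈ 𝔓.inertia (absoluteGaloisGroup ℚ), x * ρ s * x⁻¹ = sigma := by
      have h : sigma ∈ (𝔓.inertia (absoluteGaloisGroup ℚ)).map
          ((MulAut.conj x).toMonoidHom.comp ρ.toMonoidHom) := by
        rw [hIS]; exact Subgroup.subset_closure (by simp)
      exact h
    have hsC : x * ρ s * x⁻¹ ∉ unitsF5Tau := by rw [hfs]; exact sigma_not_mem_unitsF5Tau
    obtain ⟨φ₀, hφ₀⟩ : ∃ φ : absoluteGaloisGroup ℚ, IsArithFrobAt (𝓞 ℚ) φ 𝔓 :=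
      IsDedekindDomain.HeightOneSpectrum.exists_isArithFrobAt_of_mem_primesAbove_holds h𝔓
    obtain ⟨φ₁, hφ₁, hφ₁C⟩ : ∃ φ₁ : absoluteGaloisGroup ℚ, IsArithFrobAt (𝓞 ℚ) φ₁ 𝔓 ∧
        x * ρ φ₁ * x⁻¹ ∈ unitsF5Tau := by
      by_cases h : x * ρ φ₀ * x⁻¹ ∈ unitsF5Tau
      · exact ⟨φ₀, hφ₀, h⟩
      · refine ⟨φ₀ * s, isArithFrobAt_mul_of_mem_inertia hφ₀ hsI, ?_⟩
        rw [map_mul, show x * (ρ φ₀ * ρ s) * x⁻¹ = (x * ρ φ₀ * x⁻¹) * (x * ρ s * x⁻¹) by group]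
        exact mul_mem_unitsF5Tau_of_not_mem_of_not_mem (hN φ₀ (hF φ₀ hφ₀).1)
          (hN s (Ideal.inertia_le_decompositionSubgroup _ _ hsI)) h hsC
    obtain ⟨φ, hφ, hfφ⟩ := exists_isArithFrobAt_apply_eq_nu
      (f := (MulAut.conj x).toMonoidHom.comp ρ.toMonoidHom) htI hft hsI hfs hφ₁ hφ₁C (hF φ₁ hφ₁).2
    have hφH : φ ∈ unitsF5Tau.comap ((MulAut.conj x).toMonoidHom.comp ρ.toMonoidHom) := by
      change x * ρ φ * x⁻¹ ∈ unitsF5Tau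
      rw [show x * ρ φ * x⁻¹ = nu from hfφ]; exact nu_mem_unitsF5Tau
    exact ⟨ρ, Or.inl rfl, hdet, hwild, v, hv, 𝔓, h𝔓, x, hN, hwle, ⟨u₀, hu₀, hmap⟩,
      Or.inr ⟨hIS, φ, hφ, hφH, hfφ⟩⟩

end Literature.NumberTheory.Automorphic.BCDT

end
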